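import Literature.NumberTheory.ConnesConsani2021.ArchimedeanTraceFormula
import Literature.Analysis.OperatorTheory.IntegralOperatorHilbertSchmidt
import Mathlib.MeasureTheory.Integral.Prod
import HarnessLib

/-!
# Approximation numbers of an operator with square-integrable kernel: `μ_n(A) ≤ ‖K − K_n‖_{L²}` for
# separable `K_n` of rank `≤ n` — the Hilbert–Schmidt route to "infinite order" (App. D Lemma 47)

RH-FREE operator-theory bookkeeping (cell `rh-crit`, sub-cell cc, seat t13; serves the discharge of the
tree fact `CC2021_lemma_D47`, App. D Lemma D.1 (47) of Connes–Consani 2021, which is OFF the leaf path).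
WHAT THIS IS NOT: any claim about RH; nothing here bears on the truth of RH.  Theorems only: no
definition, no named fact (net debt 0).

For a complex kernel `K` with `uncurry K ∈ L²(μ ⊗ μ)` (`μ` s-finite) and ANY bounded operator `A` on
`L²(μ; ℂ)` acting a.e. by `(Aφ)(x) = ∫ K(x,y)φ(y) dμ(y)` — the idiom of `CC2021_lemma_D47` — we prove the
complex-scalar Hilbert–Schmidt package (the tree's `L2KernelIntegralOperator.lean` is the real-scalar one):
* `norm_sq_integral_kernel_mul_le` (row-wise Cauchy–Schwarz),
  `memLp_two_integral_kernel_mul`, `integral_norm_sq_integral_kernel_mul_le`,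
  `opNorm_le_of_l2Kernel` — **`‖A‖ ≤ ‖K‖_{L²(μ⊗μ)}`** (Reed–Simon I, Thm. VI.23);
* `finiteRankOp_coeFn`, `rank_finiteRankOp_le` — the operator `φ ↦ Σ_{i<n} ⟪c_i, φ⟫ a_i` has the separable
  kernel `Σ a_i(x) conj(c_i(y))` and rank `≤ n`;
* `exists_l2KernelOp_complex` — existence of the bounded operator with the a.e. kernel formula;
* `approxNumber_le_of_l2Kernel_sub` — **`μ_n(A) ≤ ‖K − Σ_{i<n} a_i ⊗ c̄_i‖_{L²(μ⊗μ)}`**: the approximation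
  numbers of `A` are controlled by `L²`-approximation of its kernel by separable kernels (Connes 1994,
  Chap. IV §2.α: `μ_n(T) = inf{‖T − R‖ : rank R ≤ n}`; this is how rapid decay of `μ_n([H,f])` follows from
  smooth, rapidly decaying kernels in App. D, Rem. 48's "direct kernel estimate");
* `isInfiniteOrder_of_l2Kernel_approx` — rapidly convergent separable `L²`-approximation of the kernel ⇒
  `IsInfiniteOrder A`;
* `approxNumber_le_of_l2Kernel_sub_fintype` — the bound with the separable kernel indexed by any `Fintype ι`,
  `|ι| ≤ n` (zero padding).
-/

noncomputable section

open _root_.MeasureTheory Set Filter Function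
open scoped ENNReal InnerProductSpace ComplexConjugate

namespace Literature.NumberTheory.ConnesConsani2021

open Literature.Analysis.OperatorTheory

section L2Kernel

variable {X : Type*} [MeasurableSpace X] {μ : Measure X} {K : X → X → ℂ}

/-- RH-FREE. The conjugate section `y ↦ conj K(x,y)` is in `L²` when the section is. [folklore] -/
private theorem memLp_conj_section {x : X} (hx : MemLp (K x) 2 μ) : MemLp (fun y => conj (K x y)) 2 μ := by
  rw [memLp_two_iff_integrable_sq_norm (Complex.continuous_conj.comp_aestronglyMeasurable hx.1)]
  simpa only [Complex.norm_conj] using (memLp_two_iff_integrable_sq_norm hx.1).1 hx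

/-- RH-FREE. `∫ K(x,y)φ(y) dμ(y) = ⟪conj K(x,·), φ⟫_{L²}` when the section `K(x,·)` is in `L²`.
[cite: ReedSimonI1980, Thm. VI.23] -/
theorem integral_kernel_mul_eq_inner_section {x : X} (hx : MemLp (K x) 2 μ) (φ : Lp ℂ 2 μ) :
    ∫ y, K x y * φ y ∂μ = ⟪(memLp_conj_section hx).toLp _, φ⟫_ℂ := by
  rw [L2.inner_def]
  refine integral_congr_ae ?_
  filter_upwards [(memLp_conj_section hx).coeFn_toLp] with y hy
  rw [hy, RCLike.inner_apply', Complex.conj_conj]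

/-- RH-FREE. `‖conj K(x,·)‖²_{L²} = ∫ ‖K(x,y)‖² dμ(y)`. [folklore] -/
private theorem norm_toLp_conj_section_sq {x : X} (hx : MemLp (K x) 2 μ) :
    ‖(memLp_conj_section hx).toLp _‖ ^ 2 = ∫ y, ‖K x y‖ ^ 2 ∂μ := by
  rw [norm_toLp_sq_eq_integral_norm_sq]
  simp only [Complex.norm_conj]

/-- RH-FREE. **Row-wise Cauchy–Schwarz**: `‖∫ K(x,y)φ(y)dμ(y)‖² ≤ (∫‖K(x,y)‖²dμ(y))·‖φ‖²`.
[cite: ReedSimonI1980, Thm. VI.23] -/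
theorem norm_sq_integral_kernel_mul_le {x : X} (hx : MemLp (K x) 2 μ) (φ : Lp ℂ 2 μ) :
    ‖∫ y, K x y * φ y ∂μ‖ ^ 2 ≤ (∫ y, ‖K x y‖ ^ 2 ∂μ) * ‖φ‖ ^ 2 := by
  rw [integral_kernel_mul_eq_inner_section hx, ← norm_toLp_conj_section_sq hx, ← mul_pow]
  exact pow_le_pow_left₀ (norm_nonneg _) (norm_inner_le_norm _ _) 2

/-- RH-FREE. `ψ ⊗ φ ∈ L²(μ ⊗ μ)` for `ψ, φ ∈ L²(μ)` (complex scalars; the separable kernels of finite-rank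
operators). [cite: ReedSimonI1980, Thm. VI.23] -/
theorem memLp_two_tensor {ψ φ : X → ℂ} [SFinite μ] (hψ : MemLp ψ 2 μ) (hφ : MemLp φ 2 μ) :
    MemLp (fun z : X × X => ψ z.1 * φ z.2) 2 (μ.prod μ) := by
  have hmeas : AEStronglyMeasurable (fun z : X × X => ψ z.1 * φ z.2) (μ.prod μ) :=
    hψ.1.comp_fst.mul hφ.1.comp_snd
  rw [memLp_two_iff_integrable_sq_norm hmeas]
  have h1 := (memLp_two_iff_integrable_sq_norm hψ.1).1 hψ
  have h2 := (memLp_two_iff_integrable_sq_norm hφ.1).1 hφ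
  refine (h1.mul_prod h2).congr (Eventually.of_forall fun z => ?_)
  simp only [norm_mul, mul_pow]

variable [SFinite μ]

/-- RH-FREE. For an `L²(μ ⊗ μ)` kernel almost every section `K(x,·)` is in `L²(μ)` (Tonelli) — the
complex-scalar twin of the tree's real `Literature.Analysis.OperatorTheory.ae_memLp_l2Kernel_section`
(same proof; kept private, the public API below is what is new). [cite: ReedSimonI1980, Thm. VI.23] -/
private theorem ae_memLp_kernel_section (hK : MemLp (uncurry K) 2 (μ.prod μ)) : ∀ᵐ x ∂μ, MemLp (K x) 2 μ := by
  have h1 : ∀ᵐ x ∂μ, AEStronglyMeasurable (fun y => uncurry K (x, y)) μ := hK.1.prodMk_left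
  have h2 : ∀ᵐ x ∂μ, Integrable (fun y => (fun z => ‖uncurry K z‖ ^ 2) (x, y)) μ :=
    ((memLp_two_iff_integrable_sq_norm hK.1).1 hK).prod_right_ae
  filter_upwards [h1, h2] with x hx1 hx2
  exact (memLp_two_iff_integrable_sq_norm hx1).2 hx2

/-- RH-FREE. `x ↦ ∫ ‖K(x,y)‖² dμ(y)` is integrable (Tonelli half of `‖K‖²_{L²} = ∫∫‖K‖²`). [cite: ReedSimonI1980, Thm. VI.23] -/
theorem integrable_integral_kernel_norm_sq (hK : MemLp (uncurry K) 2 (μ.prod μ)) :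
    Integrable (fun x => ∫ y, ‖K x y‖ ^ 2 ∂μ) μ :=
  ((memLp_two_iff_integrable_sq_norm hK.1).1 hK).integral_prod_left

/-- RH-FREE. `∫ (∫ ‖K(x,y)‖² dμ(y)) dμ(x) = ∫ ‖K‖² d(μ ⊗ μ)` (Fubini). [cite: ReedSimonI1980, Thm. VI.23] -/
theorem integral_integral_kernel_norm_sq (hK : MemLp (uncurry K) 2 (μ.prod μ)) :
    ∫ x, ∫ y, ‖K x y‖ ^ 2 ∂μ ∂μ = ∫ z, ‖K z.1 z.2‖ ^ 2 ∂(μ.prod μ) :=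
  (integral_prod _ ((memLp_two_iff_integrable_sq_norm hK.1).1 hK)).symm

/-- RH-FREE. `x ↦ ∫ K(x,y)φ(y) dμ(y)` is a.e.-strongly measurable (Fubini integrand). [cite: ReedSimonI1980, Thm. VI.23] -/
theorem aestronglyMeasurable_integral_kernel_mul (hK : AEStronglyMeasurable (uncurry K) (μ.prod μ))
    (φ : Lp ℂ 2 μ) : AEStronglyMeasurable (fun x => ∫ y, K x y * φ y ∂μ) μ := by
  have h : AEStronglyMeasurable (fun z : X × X => K z.1 z.2 * φ z.2) (μ.prod μ) :=
    hK.mul (Lp.aestronglyMeasurable φ).comp_snd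
  exact h.integral_prod_right'

/-- RH-FREE. **`Aφ ∈ L²`**: `x ↦ ∫ K(x,y)φ(y)dμ(y)` is square integrable, dominated by
`‖φ‖(∫‖K(x,y)‖²dμ(y))^{1/2}`. [cite: ReedSimonI1980, Thm. VI.23] -/
theorem memLp_two_integral_kernel_mul (hK : MemLp (uncurry K) 2 (μ.prod μ)) (φ : Lp ℂ 2 μ) :
    MemLp (fun x => ∫ y, K x y * φ y ∂μ) 2 μ := by
  have hR := integrable_integral_kernel_norm_sq hK
  have hg : MemLp (fun x => Real.sqrt (∫ y, ‖K x y‖ ^ 2 ∂μ)) 2 μ := by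
    rw [memLp_two_iff_integrable_sq_norm (Real.continuous_sqrt.comp_aestronglyMeasurable hR.1)]
    refine hR.congr (Eventually.of_forall fun x => ?_)
    dsimp only
    rw [Real.norm_of_nonneg (Real.sqrt_nonneg _), Real.sq_sqrt (integral_nonneg fun y => sq_nonneg _)]
  refine MemLp.of_le_mul (c := ‖φ‖) hg (aestronglyMeasurable_integral_kernel_mul hK.1 φ) ?_
  filter_upwards [ae_memLp_kernel_section hK] with x hx
  rw [Real.norm_of_nonneg (Real.sqrt_nonneg _), mul_comm, ← Real.sqrt_sq (norm_nonneg φ),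
    ← Real.sqrt_mul (integral_nonneg fun y => sq_nonneg _)]
  exact Real.le_sqrt_of_sq_le (norm_sq_integral_kernel_mul_le hx φ)

/-- RH-FREE. **The `L²` bound** `∫ ‖∫ K(x,y)φ(y)dμ(y)‖² dμ(x) ≤ ‖K‖²_{L²(μ⊗μ)}‖φ‖²`.
[cite: ReedSimonI1980, Thm. VI.23] -/
theorem integral_norm_sq_integral_kernel_mul_le (hK : MemLp (uncurry K) 2 (μ.prod μ)) (φ : Lp ℂ 2 μ) :
    ∫ x, ‖∫ y, K x y * φ y ∂μ‖ ^ 2 ∂μ ≤ (∫ z, ‖K z.1 z.2‖ ^ 2 ∂(μ.prod μ)) * ‖φ‖ ^ 2 := by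
  rw [← integral_integral_kernel_norm_sq hK, ← integral_mul_const]
  refine integral_mono_ae ((memLp_two_iff_integrable_sq_norm
      (aestronglyMeasurable_integral_kernel_mul hK.1 φ)).1 (memLp_two_integral_kernel_mul hK φ))
    ((integrable_integral_kernel_norm_sq hK).mul_const _) ?_
  filter_upwards [ae_memLp_kernel_section hK] with x hx
  exact norm_sq_integral_kernel_mul_le hx φ

/-- RH-FREE. **`‖A‖ ≤ ‖K‖_{L²(μ⊗μ)}` for ANY bounded `A` acting a.e. by the kernel `K`** (Reed–Simon I,
Thm. VI.23: an `L²` kernel gives a Hilbert–Schmidt operator and `‖A‖ ≤ ‖A‖_{HS} = ‖K‖_{L²}`).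
[cite: ReedSimonI1980, Thm. VI.23] -/
theorem opNorm_le_of_l2Kernel (hK : MemLp (uncurry K) 2 (μ.prod μ))
    {A : Lp ℂ 2 μ →L[ℂ] Lp ℂ 2 μ}
    (hA : ∀ φ : Lp ℂ 2 μ, (A φ : X → ℂ) =ᵐ[μ] fun x => ∫ y, K x y * φ y ∂μ) :
    ‖A‖ ≤ Real.sqrt (∫ z, ‖K z.1 z.2‖ ^ 2 ∂(μ.prod μ)) := by
  refine ContinuousLinearMap.opNorm_le_bound _ (Real.sqrt_nonneg _) fun φ => ?_
  have hmem := memLp_two_integral_kernel_mul hK φ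
  have hAφ : A φ = hmem.toLp _ := by
    apply Lp.ext
    exact (hA φ).trans hmem.coeFn_toLp.symm
  have h : ‖A φ‖ ^ 2 ≤ (∫ z, ‖K z.1 z.2‖ ^ 2 ∂(μ.prod μ)) * ‖φ‖ ^ 2 := by
    rw [hAφ, norm_toLp_sq_eq_integral_norm_sq]
    exact integral_norm_sq_integral_kernel_mul_le hK φ
  rw [← abs_norm, ← Real.sqrt_sq (norm_nonneg φ), ← Real.sqrt_mul (integral_nonneg fun z => sq_nonneg _)]
  exact Real.abs_le_sqrt h

/-- RH-FREE. **The integral operator of a square-integrable complex kernel** (Reed–Simon I, Thm. VI.23): for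
`uncurry K ∈ L²(μ ⊗ μ)` there is a bounded operator `A` on `L²(μ; ℂ)` with `(Aφ)(x) = ∫ K(x,y)φ(y)dμ(y)`
a.e. (existence statement, no definition introduced; `A` is unique by `Lp.ext` and `‖A‖ ≤ ‖K‖_{L²}` by
`opNorm_le_of_l2Kernel`).  Complex-scalar twin of the tree's real `exists_l2KernelOp`.
[cite: ReedSimonI1980, Thm. VI.23] -/
theorem exists_l2KernelOp_complex (hK : MemLp (uncurry K) 2 (μ.prod μ)) :
    ∃ A : Lp ℂ 2 μ →L[ℂ] Lp ℂ 2 μ,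
      ∀ φ : Lp ℂ 2 μ, (A φ : X → ℂ) =ᵐ[μ] fun x => ∫ y, K x y * φ y ∂μ := by
  set F : Lp ℂ 2 μ → X → ℂ := fun φ x => ∫ y, K x y * φ y ∂μ with hF
  have hmem : ∀ φ, MemLp (F φ) 2 μ := fun φ => memLp_two_integral_kernel_mul hK φ
  have hint : ∀ {x : X}, MemLp (K x) 2 μ → ∀ φ : Lp ℂ 2 μ, Integrable (fun y => K x y * φ y) μ :=
    fun hx φ => hx.integrable_mul (Lp.memLp φ)
  set L : Lp ℂ 2 μ →ₗ[ℂ] Lp ℂ 2 μ :=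
    { toFun := fun φ => (hmem φ).toLp (F φ)
      map_add' := fun φ ψ => by
        rw [← MemLp.toLp_add (hmem φ) (hmem ψ), MemLp.toLp_eq_toLp_iff]
        filter_upwards [ae_memLp_kernel_section hK] with x hx
        change F (φ + ψ) x = F φ x + F ψ x
        simp only [hF]
        rw [← integral_add (hint hx φ) (hint hx ψ)]
        refine integral_congr_ae ?_
        filter_upwards [Lp.coeFn_add φ ψ] with y hy
        rw [hy, Pi.add_apply, mul_add]
      map_smul' := fun c φ => by
        rw [RingHom.id_apply, ← MemLp.toLp_const_smul, MemLp.toLp_eq_toLp_iff]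
        filter_upwards with x
        change F (c • φ) x = c • F φ x
        simp only [hF]
        rw [smul_eq_mul, ← integral_const_mul]
        refine integral_congr_ae ?_
        filter_upwards [Lp.coeFn_smul c φ] with y hy
        rw [hy, Pi.smul_apply, smul_eq_mul]
        ring } with hL
  have hLapply : ∀ φ, L φ = (hmem φ).toLp (F φ) := fun φ => rfl
  have hbound : ∀ φ, ‖L φ‖ ≤ Real.sqrt (∫ z, ‖K z.1 z.2‖ ^ 2 ∂(μ.prod μ)) * ‖φ‖ := by
    intro φ
    have h : ‖L φ‖ ^ 2 ≤ (∫ z, ‖K z.1 z.2‖ ^ 2 ∂(μ.prod μ)) * ‖φ‖ ^ 2 := by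
      rw [hLapply, norm_toLp_sq_eq_integral_norm_sq]
      exact integral_norm_sq_integral_kernel_mul_le hK φ
    rw [← abs_norm, ← Real.sqrt_sq (norm_nonneg φ),
      ← Real.sqrt_mul (integral_nonneg fun z => sq_nonneg _)]
    exact Real.abs_le_sqrt h
  refine ⟨L.mkContinuousOfExistsBound ⟨_, hbound⟩, fun φ => ?_⟩
  rw [LinearMap.mkContinuousOfExistsBound_apply, hLapply]
  exact (hmem φ).coeFn_toLp

end L2Kernel

/-! ### Separable kernels: the finite-rank operators `φ ↦ Σ_i ⟪c_i, φ⟫ a_i` -/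

section Separable

variable {X : Type*} [MeasurableSpace X] {μ : Measure X}

/-- RH-FREE. `conj ∘ f ∈ L²` for `f ∈ L²`. [folklore] -/
private theorem memLp_conj {f : X → ℂ} (hf : MemLp f 2 μ) : MemLp (fun y => conj (f y)) 2 μ := by
  rw [memLp_two_iff_integrable_sq_norm (Complex.continuous_conj.comp_aestronglyMeasurable hf.1)]
  simpa only [Complex.norm_conj] using (memLp_two_iff_integrable_sq_norm hf.1).1 hf

/-- RH-FREE. Pointwise form of a finite sum of scalar multiples in `L²`. [folklore] -/
private theorem coeFn_sum_smul {n : ℕ} (b : Fin n → ℂ) (a : Fin n → Lp ℂ 2 μ) (s : Finset (Fin n)) :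
    ((∑ i ∈ s, b i • a i : Lp ℂ 2 μ) : X → ℂ) =ᵐ[μ] fun x => ∑ i ∈ s, b i * (a i : X → ℂ) x := by
  induction s using Finset.induction_on with
  | empty =>
    simp only [Finset.sum_empty]
    filter_upwards [Lp.coeFn_zero ℂ 2 μ] with x hx
    rw [hx, Pi.zero_apply]
  | insert j s hj ih =>
    rw [Finset.sum_insert hj]
    refine (Lp.coeFn_add _ _).trans ?_
    filter_upwards [ih, Lp.coeFn_smul (b j) (a j)] with x hx hs
    rw [Pi.add_apply, hx, hs, Pi.smul_apply, smul_eq_mul, Finset.sum_insert hj]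

/-- RH-FREE. **The operator `φ ↦ Σ_i ⟪c_i, φ⟫ a_i` acts by the separable kernel `Σ_i a_i(x) conj(c_i(y))`**:
`(Fφ)(x) = ∫ (Σ_i a_i(x) conj c_i(y)) φ(y) dμ(y)` a.e. [cite: Connes1994, Chap. IV §2.α] -/
theorem finiteRankOp_coeFn {n : ℕ} (a c : Fin n → Lp ℂ 2 μ) (φ : Lp ℂ 2 μ) :
    ((∑ i, (innerSL ℂ (c i)).smulRight (a i) : Lp ℂ 2 μ →L[ℂ] Lp ℂ 2 μ) φ : X → ℂ) =ᵐ[μ]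
      fun x => ∫ y, (∑ i, (a i : X → ℂ) x * conj ((c i : X → ℂ) y)) * φ y ∂μ := by
  have hint : ∀ i, Integrable (fun y => conj ((c i : X → ℂ) y) * φ y) μ := fun i =>
    (L2.integrable_inner (𝕜 := ℂ) (c i) φ).congr
      (Eventually.of_forall fun y => RCLike.inner_apply' _ _)
  have hinner : ∀ i, ⟪c i, φ⟫_ℂ = ∫ y, conj ((c i : X → ℂ) y) * φ y ∂μ := fun i => by
    rw [L2.inner_def]
    exact integral_congr_ae (Eventually.of_forall fun y => RCLike.inner_apply' _ _)
  have hL : ((∑ i, (innerSL ℂ (c i)).smulRight (a i) : Lp ℂ 2 μ →L[ℂ] Lp ℂ 2 μ) φ : X → ℂ) =ᵐ[μ]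
      fun x => ∑ i, ⟪c i, φ⟫_ℂ * (a i : X → ℂ) x := by
    simp only [FunLike.coe_sum, Finset.sum_apply, ContinuousLinearMap.smulRight_apply,
      innerSL_apply_apply]
    exact coeFn_sum_smul (fun i => ⟪c i, φ⟫_ℂ) a Finset.univ
  refine hL.trans (Eventually.of_forall fun x => ?_)
  simp only [Finset.sum_mul, mul_assoc]
  rw [integral_finsetSum _ fun i _ => (hint i).const_mul ((a i : X → ℂ) x)]
  refine Finset.sum_congr rfl fun i _ => ?_
  rw [integral_const_mul, hinner i, mul_comm]

/-- RH-FREE. **The operator `φ ↦ Σ_{i<n} ⟪c_i, φ⟫ a_i` has rank `≤ n`** (its range lies in `span{a_i}`).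
[cite: Connes1994, Chap. IV §2.α] -/
theorem rank_finiteRankOp_le {n : ℕ} (a c : Fin n → Lp ℂ 2 μ) :
    Module.rank ℂ (LinearMap.range
      ((∑ i, (innerSL ℂ (c i)).smulRight (a i) : Lp ℂ 2 μ →L[ℂ] Lp ℂ 2 μ) : Lp ℂ 2 μ →ₗ[ℂ] Lp ℂ 2 μ)) ≤ n := by
  have hle : LinearMap.range
      ((∑ i, (innerSL ℂ (c i)).smulRight (a i) : Lp ℂ 2 μ →L[ℂ] Lp ℂ 2 μ) : Lp ℂ 2 μ →ₗ[ℂ] Lp ℂ 2 μ)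
      ≤ Submodule.span ℂ (Set.range a) := by
    rintro _ ⟨φ, rfl⟩
    rw [ContinuousLinearMap.coe_coe]
    simp only [FunLike.coe_sum, Finset.sum_apply, ContinuousLinearMap.smulRight_apply,
      innerSL_apply_apply]
    exact Submodule.sum_mem _ fun i _ => Submodule.smul_mem _ _ (Submodule.subset_span ⟨i, rfl⟩)
  haveI : Module.Finite ℂ (Submodule.span ℂ (Set.range a)) :=
    Module.Finite.span_of_finite ℂ (Set.finite_range a)
  calc _ ≤ Module.rank ℂ (Submodule.span ℂ (Set.range a)) := Submodule.rank_mono hle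
    _ = (Module.finrank ℂ (Submodule.span ℂ (Set.range a)) : Cardinal) :=
        (Module.finrank_eq_rank _ _).symm
    _ ≤ (Fintype.card (Fin n) : Cardinal) := by exact_mod_cast finrank_range_le_card a
    _ = n := by rw [Fintype.card_fin]

variable [SFinite μ]

/-- RH-FREE. **`μ_n(A) ≤ ‖K − Σ_{i<n} a_i ⊗ c̄_i‖_{L²(μ⊗μ)}`**: the approximation numbers of an operator
with square-integrable kernel are bounded by the `L²` distance of the kernel to separable kernels of
rank `≤ n` (`μ_n(A) ≤ ‖A − F‖ ≤ ‖A − F‖_{HS}`).  [cite: Connes1994, Chap. IV §2.α; ReedSimonI1980, Thm. VI.23;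
ConnesConsani2021, App. D Rem. 48 p. 33 (arXiv chunk p0033:L39–41)] -/
theorem approxNumber_le_of_l2Kernel_sub {K : X → X → ℂ} (hK : MemLp (uncurry K) 2 (μ.prod μ))
    {A : Lp ℂ 2 μ →L[ℂ] Lp ℂ 2 μ}
    (hA : ∀ φ : Lp ℂ 2 μ, (A φ : X → ℂ) =ᵐ[μ] fun x => ∫ y, K x y * φ y ∂μ)
    {n : ℕ} (a c : Fin n → Lp ℂ 2 μ) :
    approxNumber A n ≤ Real.sqrt (∫ z, ‖K z.1 z.2 -
      ∑ i, (a i : X → ℂ) z.1 * conj ((c i : X → ℂ) z.2)‖ ^ 2 ∂(μ.prod μ)) := by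
  set F : Lp ℂ 2 μ →L[ℂ] Lp ℂ 2 μ := ∑ i, (innerSL ℂ (c i)).smulRight (a i) with hF
  -- the separable kernel is in `L²(μ ⊗ μ)`
  have hS : MemLp (fun z : X × X => ∑ i, (a i : X → ℂ) z.1 * conj ((c i : X → ℂ) z.2)) 2 (μ.prod μ) :=
    memLp_finsetSum Finset.univ (f := fun i (z : X × X) => (a i : X → ℂ) z.1 * conj ((c i : X → ℂ) z.2))
      fun i _ => memLp_two_tensor (Lp.memLp (a i)) (memLp_conj (Lp.memLp (c i)))
  have hK' : MemLp (uncurry fun x y => K x y - ∑ i, (a i : X → ℂ) x * conj ((c i : X → ℂ) y)) 2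
      (μ.prod μ) := hK.sub hS
  -- `A − F` acts by the difference kernel
  have hA' : ∀ φ : Lp ℂ 2 μ, ((A - F) φ : X → ℂ) =ᵐ[μ]
      fun x => ∫ y, (K x y - ∑ i, (a i : X → ℂ) x * conj ((c i : X → ℂ) y)) * φ y ∂μ := by
    intro φ
    have hsub : (A - F) φ = A φ - F φ := rfl
    rw [hsub]
    refine (Lp.coeFn_sub _ _).trans ?_
    filter_upwards [hA φ, finiteRankOp_coeFn a c φ, ae_memLp_kernel_section hK] with x h1 h2 hx
    have hi1 : Integrable (fun y => K x y * φ y) μ := hx.integrable_mul (Lp.memLp φ)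
    have hi2 : Integrable (fun y => (∑ i, (a i : X → ℂ) x * conj ((c i : X → ℂ) y)) * φ y) μ := by
      simp only [Finset.sum_mul, mul_assoc]
      exact integrable_finsetSum _ fun i _ =>
        ((L2.integrable_inner (𝕜 := ℂ) (c i) φ).congr
          (Eventually.of_forall fun y => RCLike.inner_apply' _ _)).const_mul ((a i : X → ℂ) x)
    rw [Pi.sub_apply, h1, hF, h2, ← integral_sub hi1 hi2]
    exact integral_congr_ae (Eventually.of_forall fun y => by ring)
  -- `μ_n(A) ≤ ‖A − F‖ ≤ ‖K − K_n‖_{L²}`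
  have hrank := rank_finiteRankOp_le (μ := μ) a c
  have h1 : approxNumber A n ≤ ‖A - F‖ :=
    csInf_le ⟨0, by rintro r ⟨G, -, rfl⟩; exact norm_nonneg _⟩ ⟨F, hrank, rfl⟩
  exact h1.trans (opNorm_le_of_l2Kernel hK' hA')

/-- RH-FREE. **Infinite order from rapidly convergent separable `L²`-approximation of the kernel**: if for
every `k` there is `C_k` such that for every `n` the kernel is within `C_k(n+1)^{−k}` in `L²(μ⊗μ)` of a
separable kernel `Σ_{i<n} a_i ⊗ c̄_i`, then every bounded `A` acting a.e. by the kernel is of infinite order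
(`IsInfiniteOrder`) — the form in which App. D Rem. 48's "direct kernel estimate" is used.
[cite: ConnesConsani2021, App. D Rem. 48 p. 33 (arXiv chunk p0033:L39–41); Connes1994, Chap. IV §2.α] -/
theorem isInfiniteOrder_of_l2Kernel_approx {K : X → X → ℂ} (hK : MemLp (uncurry K) 2 (μ.prod μ))
    {A : Lp ℂ 2 μ →L[ℂ] Lp ℂ 2 μ}
    (hA : ∀ φ : Lp ℂ 2 μ, (A φ : X → ℂ) =ᵐ[μ] fun x => ∫ y, K x y * φ y ∂μ)
    (h : ∀ k : ℕ, ∃ C : ℝ, ∀ n : ℕ, ∃ a c : Fin n → Lp ℂ 2 μ,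
      Real.sqrt (∫ z, ‖K z.1 z.2 - ∑ i, (a i : X → ℂ) z.1 * conj ((c i : X → ℂ) z.2)‖ ^ 2 ∂(μ.prod μ))
        * ((n : ℝ) + 1) ^ k ≤ C) :
    IsInfiniteOrder A := by
  intro k
  obtain ⟨C, hC⟩ := h k
  refine ⟨C, fun n => ?_⟩
  obtain ⟨a, c, hle⟩ := hC n
  exact (mul_le_mul_of_nonneg_right (approxNumber_le_of_l2Kernel_sub hK hA a c) (by positivity)).trans hle

/-- RH-FREE. **`μ_n(A) ≤ ‖K − Σ_{j∈ι} a_j ⊗ c̄_j‖_{L²(μ⊗μ)}` for any finite index type with `|ι| ≤ n`** — the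
approximation-number bound of `approxNumber_le_of_l2Kernel_sub` with the separable kernel indexed by an arbitrary
`Fintype` (pad with zero vectors; the padded kernel agrees with the given one `μ⊗μ`-a.e.), the form in which
structured families (quadrant × box × degree) of separable pieces are used in App. D Rem. 48's direct kernel
estimate.  [cite: ConnesConsani2021, App. D Rem. 48 p. 33 (arXiv chunk p0033:L39–41); Connes1994, Chap. IV §2.α] -/
theorem approxNumber_le_of_l2Kernel_sub_fintype {K : X → X → ℂ} (hK : MemLp (uncurry K) 2 (μ.prod μ))
    {A : Lp ℂ 2 μ →L[ℂ] Lp ℂ 2 μ}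
    (hA : ∀ φ : Lp ℂ 2 μ, (A φ : X → ℂ) =ᵐ[μ] fun x => ∫ y, K x y * φ y ∂μ)
    {ι : Type*} [Fintype ι] {n : ℕ} (hn : Fintype.card ι ≤ n) (a c : ι → Lp ℂ 2 μ) :
    approxNumber A n ≤ Real.sqrt (∫ z, ‖K z.1 z.2 -
      ∑ j, (a j : X → ℂ) z.1 * conj ((c j : X → ℂ) z.2)‖ ^ 2 ∂(μ.prod μ)) := by
  classical
  -- an embedding `ι ↪ Fin n` and the zero-padded families
  set e : ι ↪ Fin n := (Fintype.equivFin ι).toEmbedding.trans (Fin.castLEEmb hn) with he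
  set a' : Fin n → Lp ℂ 2 μ := Function.extend e a 0 with ha'
  set c' : Fin n → Lp ℂ 2 μ := Function.extend e c 0 with hc'
  have ha'e : ∀ j, a' (e j) = a j := fun j => by rw [ha', e.injective.extend_apply]
  have hc'e : ∀ j, c' (e j) = c j := fun j => by rw [hc', e.injective.extend_apply]
  have ha'0 : ∀ i, (¬ ∃ j, e j = i) → a' i = 0 := fun i hi => by
    rw [ha', Function.extend_apply' _ _ _ hi, Pi.zero_apply]
  -- off the range of `e` the padded vectors vanish a.e.; so the padded kernel agrees with the given one a.e.
  have hx : ∀ᵐ x ∂μ, ∀ i : Fin n, (¬ ∃ j, e j = i) → (a' i : X → ℂ) x = 0 := by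
    refine ae_all_iff.2 fun i => ?_
    by_cases hi : ∃ j, e j = i
    · exact Eventually.of_forall fun x h => (h hi).elim
    · rw [ha'0 i hi]
      filter_upwards [Lp.coeFn_zero ℂ 2 μ] with x hx0
      exact fun _ => by rw [hx0, Pi.zero_apply]
  have hz : ∀ᵐ z ∂(μ.prod μ), ∑ i, (a' i : X → ℂ) z.1 * conj ((c' i : X → ℂ) z.2) =
      ∑ j, (a j : X → ℂ) z.1 * conj ((c j : X → ℂ) z.2) := by
    filter_upwards [(Measure.quasiMeasurePreserving_fst (μ := μ) (ν := μ)).ae hx] with z hz1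
    -- split the sum over `Fin n` into the range of `e` and its complement
    rw [← Finset.sum_subset (Finset.subset_univ (Finset.univ.map e))
        (fun i _ hi => by
          have hi' : ¬ ∃ j, e j = i := fun ⟨j, hj⟩ => hi (Finset.mem_map.2 ⟨j, Finset.mem_univ _, hj⟩)
          rw [hz1 i hi', zero_mul]),
      Finset.sum_map]
    refine Finset.sum_congr rfl fun j _ => ?_
    rw [ha'e, hc'e]
  calc approxNumber A n
      ≤ Real.sqrt (∫ z, ‖K z.1 z.2 - ∑ i, (a' i : X → ℂ) z.1 * conj ((c' i : X → ℂ) z.2)‖ ^ 2 ∂(μ.prod μ)) :=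
        approxNumber_le_of_l2Kernel_sub hK hA a' c'
    _ = Real.sqrt (∫ z, ‖K z.1 z.2 - ∑ j, (a j : X → ℂ) z.1 * conj ((c j : X → ℂ) z.2)‖ ^ 2 ∂(μ.prod μ)) := by
        congr 1
        refine integral_congr_ae ?_
        filter_upwards [hz] with z hz'
        rw [hz']


end Separable

end Literature.NumberTheory.ConnesConsani2021
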